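import Literature.MathematicalPhysics.QuantumFieldTheory.Balaban1983to89.B9B8KnitLetterCoercive
import Literature.MathematicalPhysics.QuantumFieldTheory.Balaban1983to89.B9B8KnitVsTaxicabReg335

/-!
# `Balaban1983to89.B9B8KnitLetterCoerciveReg335` — T. Bałaban, *Propagators for lattice gauge theories in a background field*, Commun. Math. Phys. **99**
# (1985) 389–434 [Balaban1985BackgroundPropagators], Thm 3.1 p. 397 ∕ Thm 3.11 p. 416 with (3.19) p. 393, (3.24) p. 394, (3.35) p. 396; T. Bałaban, *Averaging
# operations for lattice gauge theories*, Commun. Math. Phys. **98** (1985) 17–51 [Balaban1985Averaging], Prop. 2 p. 26: ★★★ THE UNIFORM COERCIVITY OF `Δ′_a(U)`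
# AT PRINT's KNIT SITE TRANSPORTER `parKnitY` ON THE MEMBER's LOCAL CLASS (3.35) — `B9B8KnitLetterCoercive` §3 RE-PRESSED REGIME-FREE: the global class-(52)
# hypothesis `pdev (liftCfg U) < α₀′(L^k)⁻²` REMOVED, the knit-vs-taxicab closeness and the knit legs' unitarity read on (3.35) itself
# (`B9B8KnitVsTaxicabReg335`, `B9Eq3124HZKnitPairReg335Y`)

statement-level skeleton of published theorems with citation tags; proofs where landed; nothing here is a claim about the Yang–Mills mass gap

THE PRINT.  Thm 3.1 p. 397 for backgrounds in (3.35) with `M` large, `α₀` small; p. 395 «the operator Δ′_a is positive»; Thm 3.11 p. 416; the contours of (3.19)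
p. 393 are [Balaban1985Averaging]'s averaged contour variables `Ū(Γ)` ((52)–(53) p. 26) — the KNIT site transporter `parKnitY` of the N06 certificate «K»
(CASCADE-K, director-ym №383; node00-def-Y's ruling: the letter `parS` of the knit record = `parKnitY`, averaging role).

WHY THIS FILE (dag-n06-d g25 K3-D CENSUS 2026-08-30 «GENUINE KNIT ESTIMATE needed: (3.46) for G′(parKnitY) ([B8] knit Thm 3.1, n06-l `B9B8KnitLetterCoerciveReg335`
lineage) → `h46K`»).  Every site estimate of Thm 3.1 at `G′ = η²Δ′_a⁻¹` rests on ONE analytic input: the uniform coercivity `κ·Σ_z (L^{lev z})⁻²·HS(Φ z) ≤ Re⟨Φ, Δ′_a(U)Φ⟩`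
on the class.  At the straight transporter `parSymY` it is dag-n06-w1's `B9Thm31SiteCoerciveReg335Y.trIP_deltaPrimeAY_parSymY_ge_levelMass` (`κ = 1∕8`); at `parKnitY`
J-B's `B9B8KnitLetterCoercive.trIP_deltaPrimeAY_parKnitY_ge_levelMass` (`κ = 1∕32`) transfers it through the knit-vs-taxicab closeness, but keyed to the GLOBAL [B7] class (52)
of the lifted background — a hypothesis the member's LOCAL class (3.35) does not supply (dag-n06-j, LOCATED (52)).  THIS FILE removes it:
* §1 ★★ `trIP_deltaPrimeAY_parKnitY_ge_levelMass_of_close` — THE TRANSFER LEMMA, regime-free: for `G ≤ U(N)`, `U` and the knit legs `G`-valued, a UNIFORM closeness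
  `‖parSymY U c_s z − parKnitY U c_s z‖ ≤ δ` on every block with `8δ² ≤ 1∕16`, and ANY coercivity `(1∕8)·Σ ≤ Re⟨Φ, Δ′_a(U; parSymY)Φ⟩` (displayed):
  `(1∕32)·Σ_z (L^{lev z})⁻²·HS(Φ z) ≤ Re⟨Φ, Δ′_a(U; parKnitY)Φ⟩` — J-B's §3 proof verbatim with the level factor `(Lʲ∕L^k)² ≤ 1` no longer needed;
* §2 ★★★ `trIP_deltaPrimeAY_parKnitY_ge_levelMass_of_reg335P` — on the member's local class `(bg9KP (M_N ℂ) G i).Reg335 c₀ α₀` (`c₀ ≤ 10`, `0 ≤ Mα₀`) with the x-free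
  knit numerics `0 < α₀′`, `C₀α₀′ ≤ ⅓`, `2α₀′ ≤ c₂′`, `(d+1)²α₀′ ≤ 1∕100`, `K_pl(Mα₀)·L⁴ < α₀′`: closeness `δ := 8(d+1)²α₀′` by this seat's `norm_parKnitY_sub_parSymY_le_of_reg335P`
  (no (52)), knit legs unitary by F5's `parKnitY_mem_unitary_of_reg335P`; the parSymY coercivity DISPLAYED (`hsym`) — and ★★★ `…_of_reg335P_reg335` with `hsym` DISCHARGED
  by dag-n06-w1 on def-Y's typed class `(bg9K (M_N ℂ) G i).Reg335 c α₀` (`0 ≤ cMα₀`, `cMα₀(d+1) ≤ 1∕16`); ★★ `trIP_deltaPrimeAY_parKnitY_ge_of_reg335P_reg335` — the uniform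
  `(1∕32)·(L^k)⁻²·⟨Φ, Φ⟩` lower bound (so `‖G′(U; parKnitY)‖ ≤ 32·L^{2k}` uniformly on the class).
HONEST SCOPE.  One finite lattice operator at a time, constants explicit; the parSymY coercivity is dag-n06-w1's theorem (or displayed); nothing of [B9] beyond it asserted;
NOT a node discharge; count-neutral; nothing continuum ∕ OS ∕ mass gap ∕ Clay.  Cell `pub-ymgap` (D-0062), Track A node N06 [B9], seat `pub-ymgap-dag-n06-l` (g37),
2026-08-30; a NEW file (J-B's `B9B8KnitLetterCoercive` untouched).
-/

noncomputable section

namespace Literature.MathematicalPhysics.QuantumFieldTheory.Balaban1983to89.B9B8KnitLetterCoerciveReg335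

open B9Thm311ReadingCoords B9Thm311DeltaPrimePos B9Ineq369CurvatureSmallAtLettersY Node00
open B6KLevelCensusIndexV1 B6Geom246MultiLevelBox B6MultiLevelBoxOperator B9Eq39Adjoint B9BackgroundsKLevelV1 B6GlobalChartV1
open B4Lower18 (RBond rsrc rtgt rblk)
open B7Prop1Explicit (U1 mem_U1)
open B7Prop2Explicit (pdev C0 c2' unitaryUnits unitaryUnits_le_U1)
open B9B8CarrierDictionary (liftCfg)
open B9B8AveragingJunction (parKnitY parKnitY_inv)
open B9B8KnitVsTaxicabReg335 (norm_parKnitY_sub_parSymY_le_of_reg335P)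
open B9Eq3124HZKnitPairReg335Y (parKnitY_mem_unitary_of_reg335P)
open B9Thm31SiteCoerciveReg335Y (trIP_deltaPrimeAY_parSymY_ge_levelMass levC_mul_side_pow)
open B9B8KnitLetterCoercive (contraction_of_mem_unitary hs_blkSumY_parSymY_le_knit)
open B9C2FormBoxRegimeY (Kpl)
open B9BackgroundsKLevelV1P (bg9KP mem_of_reg335P)
open scoped Matrix Matrix.Norms.L2Operator

variable {d ℓ : ℕ} {hd : 1 ≤ d + 1} {hL : Odd (ℓ + 1) ∧ 1 < ℓ + 1} {b₀ b₁ : ℝ}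

/-! ## §1 The transfer lemma, regime-free -/

section Transfer

variable (i : KIdx d ℓ hd hL b₀ b₁) {N : ℕ} {G : Subgroup (Matrix (Fin N) (Fin N) ℂ)ˣ}

set_option maxHeartbeats 400000 in
/-- ★★ **THE COERCIVITY TRANSFER FROM `parSymY` TO `parKnitY`, REGIME-FREE**: `G ≤ U(N)`, `U` and every knit leg `G`-valued, a uniform block closeness
`‖parSymY U c_s z − parKnitY U c_s z‖ ≤ δ` with `8δ² ≤ 1∕16`, and a coercivity `(1∕8)·Σ_z (L^{lev z})⁻²·HS(Φ z) ≤ Re⟨Φ, Δ′_a(U; parSymY)Φ⟩` (displayed) give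
`(1∕32)·Σ_z (L^{lev z})⁻²·HS(Φ z) ≤ Re⟨Φ, Δ′_a(U; parKnitY)Φ⟩` (J-B's `B9B8KnitLetterCoercive` §3, the (52)-driven steps replaced by the two displayed inputs).
[cite: Balaban1985BackgroundPropagators, Thm 3.1 p.397, Thm 3.11 p.416, (3.19) p.393, (3.24) p.394; Balaban1984PropagatorsII, (2.14) p.225; Balaban1985Averaging, (52)–(53) pp.26–27] -/
theorem trIP_deltaPrimeAY_parKnitY_ge_levelMass_of_close [Nonempty (Fin N)] (hG : G ≤ B7Prop2Explicit.unitaryUnits (Matrix (Fin N) (Fin N) ℂ))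
    {U : CfgY (Matrix (Fin N) (Fin N) ℂ) i} (hU : ∀ μ x, U μ x ∈ G) (hparK : ∀ z w : SiteY i, parKnitY i U z w ∈ G)
    {δ : ℝ} (hδ1 : 8 * δ ^ 2 ≤ 1 / 16)
    (hclose : ∀ (s : BlkY i) (z : SiteY i), blkOf i.D.toDomains z = s →
      ‖(parSymY i U (blkCornerY i s) z : Matrix (Fin N) (Fin N) ℂ) - parKnitY i U (blkCornerY i s) z‖ ≤ δ)
    (hsym : ∀ Φ : SiteY i → Matrix (Fin N) (Fin N) ℂ,
      (1 / 8 : ℝ) * ∑ z : SiteY i, (((((ℓ + 1) ^ (blkOf i.D.toDomains z).1.1 : ℕ) : ℝ)) ^ 2)⁻¹ * ∑ a, ∑ b, ‖Φ z a b‖ ^ 2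
        ≤ trIP (fun _ => (1 : ℝ)) Φ (deltaPrimeAY i (parSymY i) U Φ))
    (Φ : SiteY i → Matrix (Fin N) (Fin N) ℂ) :
    (1 / 32 : ℝ) * ∑ z : SiteY i, (((((ℓ + 1) ^ (blkOf i.D.toDomains z).1.1 : ℕ) : ℝ)) ^ 2)⁻¹ * ∑ a, ∑ b, ‖Φ z a b‖ ^ 2
      ≤ trIP (fun _ => (1 : ℝ)) Φ (deltaPrimeAY i (parKnitY i) U Φ) := by
  -- the bound at the letter of record, and (3.24) at both letters
  have hsymΦ := hsym Φ
  rw [trIP_deltaPrimeAY_eq i hG (parSymY i) U (parSymY_inv_symm U) (fun z w => parSymY_mem i hU z w) hU Φ] at hsymΦ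
  rw [trIP_deltaPrimeAY_eq i hG (parKnitY i) U (fun z w => parKnitY_inv i U z w) hparK hU Φ]
  -- HS currency
  have hre : ∀ (par : SiteParY (Matrix (Fin N) (Fin N) ℂ) i) (s : BlkY i),
      (Matrix.trace ((blkSumY i par U Φ s)ᴴ * blkSumY i par U Φ s)).re = ∑ a, ∑ b, ‖blkSumY i par U Φ s a b‖ ^ 2 := fun par s => (hs_eq_re_trace _).symm
  simp only [hre] at hsymΦ ⊢
  -- the transporter dictionary, block by block, at the uniform closeness
  have hper : ∀ s : BlkY i,
      ∑ a, ∑ b, ‖blkSumY i (parSymY i) U Φ s a b‖ ^ 2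
        ≤ 2 * ∑ a, ∑ b, ‖blkSumY i (parKnitY i) U Φ s a b‖ ^ 2
          + 8 * (((ℓ + 1) ^ s.1.1 : ℕ) : ℝ) ^ (d + 1) * δ ^ 2 *
              ∑ z ∈ Finset.univ.filter (fun z : SiteY i => blkOf i.D.toDomains z = s), ∑ a, ∑ b, ‖Φ z a b‖ ^ 2 :=
    fun s => hs_blkSumY_parSymY_le_knit i U Φ s (fun z _ => contraction_of_mem_unitary hG (hparK _ _))
      (fun z _ => contraction_of_mem_unitary hG (parSymY_mem i hU _ _)) (fun z hz => hclose s z hz)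
  -- weigh the blocks by `levC_s` and sum: `levC_s·n^{d+1} = a_s·n⁻² ≤ n⁻²`
  have hsumS : ∑ s : BlkY i, levC d ℓ (aPrinted ℓ 1) s.1.1 * ∑ a, ∑ b, ‖blkSumY i (parSymY i) U Φ s a b‖ ^ 2
      ≤ 2 * ∑ s : BlkY i, levC d ℓ (aPrinted ℓ 1) s.1.1 * ∑ a, ∑ b, ‖blkSumY i (parKnitY i) U Φ s a b‖ ^ 2
        + 8 * δ ^ 2 * ∑ s : BlkY i, (((((ℓ + 1) ^ s.1.1 : ℕ) : ℝ)) ^ 2)⁻¹ *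
            ∑ z ∈ Finset.univ.filter (fun z : SiteY i => blkOf i.D.toDomains z = s), ∑ a, ∑ b, ‖Φ z a b‖ ^ 2 := by
    rw [Finset.mul_sum, Finset.mul_sum, ← Finset.sum_add_distrib]
    refine Finset.sum_le_sum fun s _ => ?_
    have hκ : 0 ≤ levC d ℓ (aPrinted ℓ 1) s.1.1 := (levC_blk_pos i s).le
    have h := mul_le_mul_of_nonneg_left (hper s) hκ
    have hκn := levC_mul_side_pow i s
    have ha1 : aPrinted ℓ 1 s.1.1 ≤ 1 := B6Prop23KLevelTorusCensus.aPrinted_le_one (by have := i.hℓ; omega) _ (one_le_level i s)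
    have hM0 : 0 ≤ ∑ z ∈ Finset.univ.filter (fun z : SiteY i => blkOf i.D.toDomains z = s), ∑ a, ∑ b, ‖Φ z a b‖ ^ 2 :=
      Finset.sum_nonneg fun _ _ => hs_nonneg _
    have hn0 : 0 ≤ (((((ℓ + 1) ^ s.1.1 : ℕ) : ℝ)) ^ 2)⁻¹ := inv_nonneg.2 (by positivity)
    have hw : levC d ℓ (aPrinted ℓ 1) s.1.1 * (8 * (((ℓ + 1) ^ s.1.1 : ℕ) : ℝ) ^ (d + 1) * δ ^ 2)
        ≤ 8 * δ ^ 2 * (((((ℓ + 1) ^ s.1.1 : ℕ) : ℝ)) ^ 2)⁻¹ := by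
      have : levC d ℓ (aPrinted ℓ 1) s.1.1 * (8 * (((ℓ + 1) ^ s.1.1 : ℕ) : ℝ) ^ (d + 1) * δ ^ 2)
          = 8 * δ ^ 2 * (aPrinted ℓ 1 s.1.1 * (((((ℓ + 1) ^ s.1.1 : ℕ) : ℝ)) ^ 2)⁻¹) := by rw [← hκn]; ring
      rw [this]
      have h8 : 0 ≤ 8 * δ ^ 2 := by positivity
      exact mul_le_mul_of_nonneg_left (by nlinarith) h8
    have hw' := mul_le_mul_of_nonneg_right hw hM0
    calc levC d ℓ (aPrinted ℓ 1) s.1.1 * ∑ a, ∑ b, ‖blkSumY i (parSymY i) U Φ s a b‖ ^ 2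
        ≤ levC d ℓ (aPrinted ℓ 1) s.1.1 * (2 * ∑ a, ∑ b, ‖blkSumY i (parKnitY i) U Φ s a b‖ ^ 2
            + 8 * (((ℓ + 1) ^ s.1.1 : ℕ) : ℝ) ^ (d + 1) * δ ^ 2 *
                ∑ z ∈ Finset.univ.filter (fun z : SiteY i => blkOf i.D.toDomains z = s), ∑ a, ∑ b, ‖Φ z a b‖ ^ 2) := h
      _ ≤ 2 * (levC d ℓ (aPrinted ℓ 1) s.1.1 * ∑ a, ∑ b, ‖blkSumY i (parKnitY i) U Φ s a b‖ ^ 2)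
            + 8 * δ ^ 2 * ((((((ℓ + 1) ^ s.1.1 : ℕ) : ℝ)) ^ 2)⁻¹ *
                ∑ z ∈ Finset.univ.filter (fun z : SiteY i => blkOf i.D.toDomains z = s), ∑ a, ∑ b, ‖Φ z a b‖ ^ 2) := by
            nlinarith [hw']
  -- regroup the mass by sites
  have hmass : ∑ s : BlkY i, (((((ℓ + 1) ^ s.1.1 : ℕ) : ℝ)) ^ 2)⁻¹ *
        ∑ z ∈ Finset.univ.filter (fun z : SiteY i => blkOf i.D.toDomains z = s), ∑ a, ∑ b, ‖Φ z a b‖ ^ 2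
      = ∑ z : SiteY i, (((((ℓ + 1) ^ (blkOf i.D.toDomains z).1.1 : ℕ) : ℝ)) ^ 2)⁻¹ * ∑ a, ∑ b, ‖Φ z a b‖ ^ 2 := by
    rw [← Finset.sum_fiberwise Finset.univ (fun z : SiteY i => blkOf i.D.toDomains z)
      (fun z => ((((((ℓ + 1) ^ (blkOf i.D.toDomains z).1.1 : ℕ) : ℝ)) ^ 2)⁻¹ * ∑ a, ∑ b, ‖Φ z a b‖ ^ 2))]
    refine Finset.sum_congr rfl fun s _ => ?_
    rw [Finset.mul_sum]
    refine Finset.sum_congr rfl fun z hz => ?_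
    rw [(Finset.mem_filter.1 hz).2]
  rw [hmass] at hsumS
  -- assemble: `(1/8)·m ≤ G + S ≤ 2(G + K) + 8δ²·m`
  have hG0 : 0 ≤ ∑ μ : Fin (d + 1), trIP (fun _ => (1 : ℝ)) (cdS i U μ Φ) (cdS i U μ Φ) :=
    Finset.sum_nonneg fun μ _ => by rw [trIP_one_self_eq]; exact Finset.sum_nonneg fun _ _ => hs_nonneg _
  have hK0 : 0 ≤ ∑ s : BlkY i, levC d ℓ (aPrinted ℓ 1) s.1.1 * ∑ a, ∑ b, ‖blkSumY i (parKnitY i) U Φ s a b‖ ^ 2 :=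
    Finset.sum_nonneg fun s _ => mul_nonneg (levC_blk_pos i s).le (hs_nonneg _)
  have hm0 : 0 ≤ ∑ z : SiteY i, (((((ℓ + 1) ^ (blkOf i.D.toDomains z).1.1 : ℕ) : ℝ)) ^ 2)⁻¹ * ∑ a, ∑ b, ‖Φ z a b‖ ^ 2 :=
    Finset.sum_nonneg fun z _ => mul_nonneg (inv_nonneg.2 (by positivity)) (hs_nonneg _)
  nlinarith [hsymΦ, hsumS, hδ1, hG0, hK0, hm0]

end Transfer

/-! ## §2 On the member's local class (3.35): closeness and knit legs from (3.35) itself; the parSymY coercivity displayed, then discharged -/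

section Reg335

variable (i : KIdx d ℓ hd hL b₀ b₁) {N : ℕ} [Nonempty (Fin N)] {G : Subgroup (Matrix (Fin N) (Fin N) ℂ)ˣ}

/-- ★★★ **THE KNIT COERCIVITY ON (3.35), parSymY's DISPLAYED**: `G ≤ U(N)`, `U ∈ (bg9KP (M_N ℂ) G i).Reg335 c₀ α₀` (`c₀ ≤ 10`, `0 ≤ Mα₀`), the x-free knit numerics
`0 < α₀′`, `C₀α₀′ ≤ ⅓`, `2α₀′ ≤ c₂′`, `(d+1)²α₀′ ≤ 1∕100`, `K_pl(Mα₀)·L⁴ < α₀′`, and the parSymY coercivity `hsym` (displayed) give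
`(1∕32)·Σ_z (L^{lev z})⁻²·HS(Φ z) ≤ Re⟨Φ, Δ′_a(U; parKnitY)Φ⟩` — §1 at `δ := 8(d+1)²α₀′` (`norm_parKnitY_sub_parSymY_le_of_reg335P`) with the knit legs unitary on the class
(F5's `parKnitY_mem_unitary_of_reg335P`), everything at `G := U(N)`. [cite: Balaban1985BackgroundPropagators, Thm 3.1 p.397, Thm 3.11 p.416, (3.19) p.393, (3.24) p.394, (3.35) p.396; Balaban1985Averaging, Prop. 2 p.26, (52)–(53) pp.26–27] -/
theorem trIP_deltaPrimeAY_parKnitY_ge_levelMass_of_reg335P (hGU : G ≤ unitaryUnits (Matrix (Fin N) (Fin N) ℂ))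
    {U : CfgY (Matrix (Fin N) (Fin N) ℂ) i} {c₀ α₀ : ℝ} (hc : c₀ ≤ 10) (hMα : 0 ≤ (kGeo i).M * α₀)
    (hreg : (bg9KP (Matrix (Fin N) (Fin N) ℂ) G i).Reg335 c₀ α₀ U) {α₀' : ℝ} (hα' : 0 < α₀') (hα3 : C0 (d + 1) * α₀' ≤ 1 / 3)
    (hα2 : 2 * α₀' ≤ c2' (d + 1) (ℓ + 1)) (hαd : ((d : ℝ) + 1) ^ 2 * α₀' ≤ 1 / 100) (hK : Kpl i ((kGeo i).M * α₀) * (kGeo i).L ^ 4 < α₀')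
    (hsym : ∀ Φ : SiteY i → Matrix (Fin N) (Fin N) ℂ,
      (1 / 8 : ℝ) * ∑ z : SiteY i, (((((ℓ + 1) ^ (blkOf i.D.toDomains z).1.1 : ℕ) : ℝ)) ^ 2)⁻¹ * ∑ a, ∑ b, ‖Φ z a b‖ ^ 2
        ≤ trIP (fun _ => (1 : ℝ)) Φ (deltaPrimeAY i (parSymY i) U Φ))
    (Φ : SiteY i → Matrix (Fin N) (Fin N) ℂ) :
    (1 / 32 : ℝ) * ∑ z : SiteY i, (((((ℓ + 1) ^ (blkOf i.D.toDomains z).1.1 : ℕ) : ℝ)) ^ 2)⁻¹ * ∑ a, ∑ b, ‖Φ z a b‖ ^ 2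
      ≤ trIP (fun _ => (1 : ℝ)) Φ (deltaPrimeAY i (parKnitY i) U Φ) := by
  letI : CStarAlgebra (Matrix (Fin N) (Fin N) ℂ) := {}
  have hG1 : ∀ u : (Matrix (Fin N) (Fin N) ℂ)ˣ, u ∈ G → ‖(u : Matrix (Fin N) (Fin N) ℂ)‖ ≤ 1 :=
    fun u hu => (B7Prop1Explicit.mem_U1.1 (unitaryUnits_le_U1 (hGU hu))).1
  have hU : ∀ μ x, U μ x ∈ unitaryUnits (Matrix (Fin N) (Fin N) ℂ) := fun μ x => hGU (mem_of_reg335P (G := G) i hreg μ x)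
  have hparK : ∀ z w : SiteY i, parKnitY i U z w ∈ unitaryUnits (Matrix (Fin N) (Fin N) ℂ) :=
    parKnitY_mem_unitary_of_reg335P i hG1 hGU U hc hMα hreg hα' hα3 hα2 hK
  have hδ1 : 8 * (8 * ((d : ℝ) + 1) ^ 2 * α₀') ^ 2 ≤ 1 / 16 := by
    nlinarith [hαd, sq_nonneg (((d : ℝ) + 1) ^ 2 * α₀'), show 0 ≤ ((d : ℝ) + 1) ^ 2 * α₀' by positivity]
  refine trIP_deltaPrimeAY_parKnitY_ge_levelMass_of_close i le_rfl hU hparK hδ1 (fun s z hz => ?_) hsym Φ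
  rw [norm_sub_rev]
  exact norm_parKnitY_sub_parSymY_le_of_reg335P i hG1 hGU hc hMα hreg hα' hα3 hα2 hK hz

/-- ★★★ **THE KNIT COERCIVITY ON (3.35), parSymY's DISCHARGED BY dag-n06-w1** on def-Y's typed class: with `U` ALSO in `(bg9K (M_N ℂ) G i).Reg335 c α₀` at `0 ≤ cMα₀`,
`cMα₀(d+1) ≤ 1∕16` (`B9Thm31SiteCoerciveReg335Y.trIP_deltaPrimeAY_parSymY_ge_levelMass`): `(1∕32)·Σ_z (L^{lev z})⁻²·HS(Φ z) ≤ Re⟨Φ, Δ′_a(U; parKnitY)Φ⟩`.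
[cite: Balaban1985BackgroundPropagators, Thm 3.1 p.397, Thm 3.11 p.416, (3.19) p.393, (3.24) p.394, (3.35) p.396; Balaban1984PropagatorsII, (2.14) p.225; Balaban1985Averaging, Prop. 2 p.26] -/
theorem trIP_deltaPrimeAY_parKnitY_ge_levelMass_of_reg335P_reg335 (hGU : G ≤ unitaryUnits (Matrix (Fin N) (Fin N) ℂ))
    {U : CfgY (Matrix (Fin N) (Fin N) ℂ) i} {c₀ α₀ : ℝ} (hc : c₀ ≤ 10) (hMα : 0 ≤ (kGeo i).M * α₀)
    (hreg : (bg9KP (Matrix (Fin N) (Fin N) ℂ) G i).Reg335 c₀ α₀ U) {α₀' : ℝ} (hα' : 0 < α₀') (hα3 : C0 (d + 1) * α₀' ≤ 1 / 3)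
    (hα2 : 2 * α₀' ≤ c2' (d + 1) (ℓ + 1)) (hαd : ((d : ℝ) + 1) ^ 2 * α₀' ≤ 1 / 100) (hK : Kpl i ((kGeo i).M * α₀) * (kGeo i).L ^ 4 < α₀')
    {c α₁ : ℝ} (hC0 : 0 ≤ c * (kGeo i).M * α₁) (hC1 : c * (kGeo i).M * α₁ * ((d : ℝ) + 1) ≤ 1 / 16)
    (hregK : (bg9K (Matrix (Fin N) (Fin N) ℂ) G i).Reg335 c α₁ U) (Φ : SiteY i → Matrix (Fin N) (Fin N) ℂ) :
    (1 / 32 : ℝ) * ∑ z : SiteY i, (((((ℓ + 1) ^ (blkOf i.D.toDomains z).1.1 : ℕ) : ℝ)) ^ 2)⁻¹ * ∑ a, ∑ b, ‖Φ z a b‖ ^ 2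
      ≤ trIP (fun _ => (1 : ℝ)) Φ (deltaPrimeAY i (parKnitY i) U Φ) :=
  trIP_deltaPrimeAY_parKnitY_ge_levelMass_of_reg335P i hGU hc hMα hreg hα' hα3 hα2 hαd hK
    (fun Φ => trIP_deltaPrimeAY_parSymY_ge_levelMass i hGU hC0 hC1 hregK Φ) Φ

/-- ★★ **THE UNIFORM `L^{−2k}` LOWER BOUND AT THE KNIT LETTER ON (3.35)**: `(1∕32)·(L^k)⁻²·⟨Φ, Φ⟩ ≤ Re⟨Φ, Δ′_a(U; parKnitY)Φ⟩` — so `G′(U; parKnitY) = η²Δ′_a⁻¹` has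
`L²`-operator norm `≤ 32·L^{2k}` uniformly on the class, the member and `N`. [cite: Balaban1985BackgroundPropagators, Thm 3.1 p.397, Thm 3.11 p.416; Balaban1984PropagatorsII, p.225] -/
theorem trIP_deltaPrimeAY_parKnitY_ge_of_reg335P_reg335 (hGU : G ≤ unitaryUnits (Matrix (Fin N) (Fin N) ℂ))
    {U : CfgY (Matrix (Fin N) (Fin N) ℂ) i} {c₀ α₀ : ℝ} (hc : c₀ ≤ 10) (hMα : 0 ≤ (kGeo i).M * α₀)
    (hreg : (bg9KP (Matrix (Fin N) (Fin N) ℂ) G i).Reg335 c₀ α₀ U) {α₀' : ℝ} (hα' : 0 < α₀') (hα3 : C0 (d + 1) * α₀' ≤ 1 / 3)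
    (hα2 : 2 * α₀' ≤ c2' (d + 1) (ℓ + 1)) (hαd : ((d : ℝ) + 1) ^ 2 * α₀' ≤ 1 / 100) (hK : Kpl i ((kGeo i).M * α₀) * (kGeo i).L ^ 4 < α₀')
    {c α₁ : ℝ} (hC0 : 0 ≤ c * (kGeo i).M * α₁) (hC1 : c * (kGeo i).M * α₁ * ((d : ℝ) + 1) ≤ 1 / 16)
    (hregK : (bg9K (Matrix (Fin N) (Fin N) ℂ) G i).Reg335 c α₁ U) (Φ : SiteY i → Matrix (Fin N) (Fin N) ℂ) :
    (1 / 32 : ℝ) * (((((ℓ + 1) ^ i.k : ℕ) : ℝ)) ^ 2)⁻¹ * trIP (fun _ => (1 : ℝ)) Φ Φ ≤ trIP (fun _ => (1 : ℝ)) Φ (deltaPrimeAY i (parKnitY i) U Φ) := by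
  refine le_trans ?_ (trIP_deltaPrimeAY_parKnitY_ge_levelMass_of_reg335P_reg335 i hGU hc hMα hreg hα' hα3 hα2 hαd hK hC0 hC1 hregK Φ)
  rw [trIP_one_self_eq, Finset.mul_sum, Finset.mul_sum]
  refine Finset.sum_le_sum fun z _ => ?_
  have hz0 : 0 ≤ ∑ a, ∑ b, ‖Φ z a b‖ ^ 2 := hs_nonneg _
  have hjk : (blkOf i.D.toDomains z).1.1 ≤ i.k := (scale_bounds i.D.toDomains _).2
  have hpow : (((ℓ + 1) ^ (blkOf i.D.toDomains z).1.1 : ℕ) : ℝ) ≤ (((ℓ + 1) ^ i.k : ℕ) : ℝ) := by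
    exact_mod_cast Nat.pow_le_pow_right (Nat.succ_pos ℓ) hjk
  have hpos : (0 : ℝ) < (((ℓ + 1) ^ (blkOf i.D.toDomains z).1.1 : ℕ) : ℝ) := by positivity
  have hinv : (((((ℓ + 1) ^ i.k : ℕ) : ℝ)) ^ 2)⁻¹ ≤ (((((ℓ + 1) ^ (blkOf i.D.toDomains z).1.1 : ℕ) : ℝ)) ^ 2)⁻¹ := by
    apply inv_anti₀ (by positivity)
    exact pow_le_pow_left₀ hpos.le hpow 2
  rw [mul_assoc]
  exact mul_le_mul_of_nonneg_left (mul_le_mul_of_nonneg_right hinv hz0) (by norm_num)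

end Reg335

end Literature.MathematicalPhysics.QuantumFieldTheory.Balaban1983to89.B9B8KnitLetterCoerciveReg335

end
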